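import Mathlib
import Summits.Ventures.PercRepro2.MixChordOStarWorlds

/-!
# The four worlds of the `o`–ROOT STAR: the plain events, the two-pin mixture, the `o`-instance bookkeeping
(blind cell PercRepro2, night-1 g24; proofs/NIGHT1-G24.md §3)

The `X = univ` versions of the world readings of MixChordOStarWorlds.lean (`prob_Q_10_univ`, …,
`prob_T'_00_univ`); the two-pin mixture `prob_eq_pin2` (`P_p(A)` over the four worlds `p[g ↦ c₁][e ↦ c₂]`);
and the `o`-instance bookkeeping `TEvent'_inter` / `TEvent'_eq` (`T′_v = Q ∩ {v ∈ C₁}`) and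
`prob_PD_v_inter` / `prob_PD_v_univ` (`P(PD_v ∩ X) = P(Q ∩ X) − P(Q ∩ {v ∈ C₂} ∩ X) − P(Q ∩ {v ∈ C₁} ∩ X)`,
from `Qsplit`).  Own code; standard axioms.
-/

namespace Summit.Ventures.PercRepro2

open UnionCluster CovForm

namespace Mix

namespace OStar

section WorldsUniv

variable {V : Type*} {E : Type*} [Fintype E] [DecidableEq E] {R : Type*} [Field R]

variable (p : E → R) {ends : E → Sym2 V} {g e f : E} {o a₁ a₂ a₃ : V}
  (hg : ends g = s(a₃, o)) (he : ends e = s(a₃, a₁))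
  (hstar : ∀ e', a₃ ∈ ends e' → e' = g ∨ e' = e) (hf : ends f = s(o, a₁))
  (hge : g ≠ e) (hgf : g ≠ f) (hef : e ≠ f) (h13 : a₁ ≠ a₃) (h23 : a₂ ≠ a₃)

/-! ### The same with `X = univ` -/

include hg hstar hge h13 h23 in
/-- `Q` in world `(1, 0)` (`a₃` a leaf at `o`). -/
lemma prob_Q_10_univ : prob (Function.update (Function.update p g 1) e 0) (avoidAll ends a₂ {a₁}) =
      prob (Function.update (Function.update p g 0) e 0) (avoidAll ends a₂ {a₁}) := by
  have h : prob (Function.update (Function.update p g 1) e 0) (avoidAll ends a₂ {a₁} ∩ Set.univ) =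
      prob (Function.update (Function.update p g 0) e 0) (avoidAll ends a₂ {a₁} ∩ Set.univ) := prob_Q_10 p hg hstar hge h13 h23 a3Free_univ
  simpa only [Set.inter_univ] using h

include hg hstar hge h13 h23 in
/-- `PD` in world `(1, 0)` (`a₃` a leaf at `o`). -/
lemma prob_PD_10_univ : prob (Function.update (Function.update p g 1) e 0) (PDEvent ends a₁ a₂ a₃) =
      prob (Function.update (Function.update p g 0) e 0) (PDEvent ends a₁ a₂ o) := by
  have h : prob (Function.update (Function.update p g 1) e 0) (PDEvent ends a₁ a₂ a₃ ∩ Set.univ) =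
      prob (Function.update (Function.update p g 0) e 0) (PDEvent ends a₁ a₂ o ∩ Set.univ) := prob_PD_10 p hg hstar hge h13 h23 a3Free_univ
  simpa only [Set.inter_univ] using h

include hg hstar hge h13 h23 in
/-- `T` in world `(1, 0)` (`a₃` a leaf at `o`). -/
lemma prob_T_10_univ : prob (Function.update (Function.update p g 1) e 0) (TEvent ends a₁ a₂ a₃) =
      prob (Function.update (Function.update p g 0) e 0) (TEvent ends a₁ a₂ o) := by
  have h : prob (Function.update (Function.update p g 1) e 0) (TEvent ends a₁ a₂ a₃ ∩ Set.univ) =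
      prob (Function.update (Function.update p g 0) e 0) (TEvent ends a₁ a₂ o ∩ Set.univ) := prob_T_10 p hg hstar hge h13 h23 a3Free_univ
  simpa only [Set.inter_univ] using h

include hg hstar hge h13 h23 in
/-- `T′` in world `(1, 0)` (`a₃` a leaf at `o`). -/
lemma prob_T'_10_univ : prob (Function.update (Function.update p g 1) e 0) (TEvent ends a₂ a₁ a₃) =
      prob (Function.update (Function.update p g 0) e 0) (TEvent ends a₂ a₁ o) := by
  have h : prob (Function.update (Function.update p g 1) e 0) (TEvent ends a₂ a₁ a₃ ∩ Set.univ) =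
      prob (Function.update (Function.update p g 0) e 0) (TEvent ends a₂ a₁ o ∩ Set.univ) := prob_T'_10 p hg hstar hge h13 h23 a3Free_univ
  simpa only [Set.inter_univ] using h

include he hstar hge h13 h23 in
/-- `Q` in world `(0, 1)` (`a₃ ≡ a₁`). -/
lemma prob_Q_01_univ : prob (Function.update (Function.update p g 0) e 1) (avoidAll ends a₂ {a₁}) =
      prob (Function.update (Function.update p g 0) e 0) (avoidAll ends a₂ {a₁}) := by
  have h : prob (Function.update (Function.update p g 0) e 1) (avoidAll ends a₂ {a₁} ∩ Set.univ) =
      prob (Function.update (Function.update p g 0) e 0) (avoidAll ends a₂ {a₁} ∩ Set.univ) := prob_Q_01 p he hstar hge h13 h23 a3Free_univ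
  simpa only [Set.inter_univ] using h

include he hstar hge h13 in
/-- `PD` in world `(0, 1)` (`a₃ ≡ a₁`). -/
lemma prob_PD_01_univ : prob (Function.update (Function.update p g 0) e 1) (PDEvent ends a₁ a₂ a₃) = 0 := by
  have h : prob (Function.update (Function.update p g 0) e 1) (PDEvent ends a₁ a₂ a₃ ∩ Set.univ) = 0 := prob_PD_01 p he hstar hge h13
  simpa only [Set.inter_univ] using h

include he hstar hge h13 h23 in
/-- `T` in world `(0, 1)` (`a₃ ≡ a₁`). -/
lemma prob_T_01_univ : prob (Function.update (Function.update p g 0) e 1) (TEvent ends a₁ a₂ a₃) = 0 := by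
  have h : prob (Function.update (Function.update p g 0) e 1) (TEvent ends a₁ a₂ a₃ ∩ Set.univ) = 0 := prob_T_01 p he hstar hge h13 h23
  simpa only [Set.inter_univ] using h

include he hstar hge h13 h23 in
/-- `T′` in world `(0, 1)` (`a₃ ≡ a₁`). -/
lemma prob_T'_01_univ : prob (Function.update (Function.update p g 0) e 1) (TEvent ends a₂ a₁ a₃) =
      prob (Function.update (Function.update p g 0) e 0) (avoidAll ends a₂ {a₁}) := by
  have h : prob (Function.update (Function.update p g 0) e 1) (TEvent ends a₂ a₁ a₃ ∩ Set.univ) =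
      prob (Function.update (Function.update p g 0) e 0) (avoidAll ends a₂ {a₁} ∩ Set.univ) := prob_T'_01 p he hstar hge h13 h23 a3Free_univ
  simpa only [Set.inter_univ] using h

include hg he hstar hf hge hgf hef h13 h23 in
/-- `Q` in world `(1, 1)` (`a₃ ≡ a₁ ≡ o`, read with the `o`-edge opened). -/
lemma prob_Q_11_univ : prob (Function.update (Function.update p g 1) e 1) (avoidAll ends a₂ {a₁}) =
      prob (Function.update (Function.update (Function.update p g 0) e 0) f 1) (avoidAll ends a₂ {a₁}) := by
  have h : prob (Function.update (Function.update p g 1) e 1) (avoidAll ends a₂ {a₁} ∩ Set.univ) =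
      prob (Function.update (Function.update (Function.update p g 0) e 0) f 1) (avoidAll ends a₂ {a₁} ∩ Set.univ) := prob_Q_11 p hg he hstar hf hge hgf hef h13 h23 a3FreeF_univ
  simpa only [Set.inter_univ] using h

include hg he hstar hf hge hgf hef h13 in
/-- `PD` in world `(1, 1)` (`a₃ ≡ a₁ ≡ o`, read with the `o`-edge opened). -/
lemma prob_PD_11_univ : prob (Function.update (Function.update p g 1) e 1) (PDEvent ends a₁ a₂ a₃) = 0 := by
  have h : prob (Function.update (Function.update p g 1) e 1) (PDEvent ends a₁ a₂ a₃ ∩ Set.univ) = 0 := prob_PD_11 p hg he hstar hf hge hgf hef h13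
  simpa only [Set.inter_univ] using h

include hg he hstar hf hge hgf hef h13 h23 in
/-- `T` in world `(1, 1)` (`a₃ ≡ a₁ ≡ o`, read with the `o`-edge opened). -/
lemma prob_T_11_univ : prob (Function.update (Function.update p g 1) e 1) (TEvent ends a₁ a₂ a₃) = 0 := by
  have h : prob (Function.update (Function.update p g 1) e 1) (TEvent ends a₁ a₂ a₃ ∩ Set.univ) = 0 := prob_T_11 p hg he hstar hf hge hgf hef h13 h23
  simpa only [Set.inter_univ] using h

include hg he hstar hf hge hgf hef h13 h23 in
/-- `T′` in world `(1, 1)` (`a₃ ≡ a₁ ≡ o`, read with the `o`-edge opened). -/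
lemma prob_T'_11_univ : prob (Function.update (Function.update p g 1) e 1) (TEvent ends a₂ a₁ a₃) =
      prob (Function.update (Function.update (Function.update p g 0) e 0) f 1) (avoidAll ends a₂ {a₁}) := by
  have h : prob (Function.update (Function.update p g 1) e 1) (TEvent ends a₂ a₁ a₃ ∩ Set.univ) =
      prob (Function.update (Function.update (Function.update p g 0) e 0) f 1) (avoidAll ends a₂ {a₁} ∩ Set.univ) := prob_T'_11 p hg he hstar hf hge hgf hef h13 h23 a3FreeF_univ
  simpa only [Set.inter_univ] using h

include hstar hge h13 h23 in
/-- `PD` in world `(0, 0)` (`a₃` isolated). -/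
lemma prob_PD_00_univ : prob (Function.update (Function.update p g 0) e 0) (PDEvent ends a₁ a₂ a₃) =
      prob (Function.update (Function.update p g 0) e 0) (avoidAll ends a₂ {a₁}) := by
  have h : prob (Function.update (Function.update p g 0) e 0) (PDEvent ends a₁ a₂ a₃ ∩ Set.univ) =
      prob (Function.update (Function.update p g 0) e 0) (avoidAll ends a₂ {a₁} ∩ Set.univ) := prob_PD_00 p hstar hge h13 h23
  simpa only [Set.inter_univ] using h

include hstar hge h23 in
/-- `T` in world `(0, 0)` (`a₃` isolated). -/
lemma prob_T_00_univ : prob (Function.update (Function.update p g 0) e 0) (TEvent ends a₁ a₂ a₃) = 0 := by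
  have h : prob (Function.update (Function.update p g 0) e 0) (TEvent ends a₁ a₂ a₃ ∩ Set.univ) = 0 := prob_T_00 p hstar hge h23
  simpa only [Set.inter_univ] using h

include hstar hge h13 in
/-- `T′` in world `(0, 0)` (`a₃` isolated). -/
lemma prob_T'_00_univ : prob (Function.update (Function.update p g 0) e 0) (TEvent ends a₂ a₁ a₃) = 0 := by
  have h : prob (Function.update (Function.update p g 0) e 0) (TEvent ends a₂ a₁ a₃ ∩ Set.univ) = 0 := prob_T'_00 p hstar hge h13
  simpa only [Set.inter_univ] using h


end WorldsUniv

/-! ## The two-pin mixture, the `univ` versions and the `o`-instance events -/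

section Mixture

variable {V : Type*} {E : Type*} [Fintype E] [DecidableEq E] {R : Type*} [Field R]

variable (p : E → R) {ends : E → Sym2 V} {g e f : E} {o a₁ a₂ a₃ : V}

omit [Fintype E] [DecidableEq E] in
/-- `T′ = Q ∩ {v ∈ C₁}` on any `X` (the mirror of `TEvent_o_inter`). -/
lemma TEvent'_inter (ends : E → Sym2 V) (a₁ a₂ v : V) (X : Set (Config E)) :
    TEvent ends a₂ a₁ v ∩ X = avoidAll ends a₂ {a₁} ∩ (connEvent ends a₁ v ∩ X) := by
  ext ω
  simp only [Set.mem_inter_iff, mem_T_iff, mem_Q_iff']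
  tauto

omit [Fintype E] [DecidableEq E] in
/-- `T′ = Q ∩ {v ∈ C₁}`. -/
lemma TEvent'_eq (ends : E → Sym2 V) (a₁ a₂ v : V) :
    TEvent ends a₂ a₁ v = avoidAll ends a₂ {a₁} ∩ connEvent ends a₁ v := by
  have := TEvent'_inter ends a₁ a₂ v Set.univ
  simpa only [Set.inter_univ] using this

/-- **The two-pin mixture**: `P_p(A)` over the four worlds of the edges `g`, `e`. -/
lemma prob_eq_pin2 (hge : g ≠ e) (A : Set (Config E)) :
    prob p A =
      (1 - p g) * (1 - p e) * prob (Function.update (Function.update p g 0) e 0) A +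
        p g * (1 - p e) * prob (Function.update (Function.update p g 1) e 0) A +
        (1 - p g) * p e * prob (Function.update (Function.update p g 0) e 1) A +
        p g * p e * prob (Function.update (Function.update p g 1) e 1) A := by
  rw [prob_eq_pin p A g, prob_eq_pin (Function.update p g 1) A e, prob_eq_pin (Function.update p g 0) A e,
    Function.update_of_ne hge.symm, Function.update_of_ne hge.symm]
  ring

/-- `P(PD_v ∩ X) = P(Q ∩ X) − P(Q ∩ {v ∈ C₂} ∩ X) − P(Q ∩ {v ∈ C₁} ∩ X)` (the `Qsplit` of `HCov.lean`). -/
lemma prob_PD_v_inter (ends : E → Sym2 V) (a₁ a₂ v : V) (X : Set (Config E)) [DecidableEq V] :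
    prob p (PDEvent ends a₁ a₂ v ∩ X) =
      prob p (avoidAll ends a₂ {a₁} ∩ X) - prob p (avoidAll ends a₂ {a₁} ∩ (connEvent ends a₂ v ∩ X)) -
        prob p (avoidAll ends a₂ {a₁} ∩ (connEvent ends a₁ v ∩ X)) := by
  have h := Qsplit p ends a₁ a₂ v X
  rw [TEvent_o_inter, TEvent'_inter] at h
  linear_combination -h

/-- `P(PD_v) = P(Q) − P(Q ∩ {v ∈ C₂}) − P(Q ∩ {v ∈ C₁})`. -/
lemma prob_PD_v_univ (ends : E → Sym2 V) (a₁ a₂ v : V) [DecidableEq V] :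
    prob p (PDEvent ends a₁ a₂ v) =
      prob p (avoidAll ends a₂ {a₁}) - prob p (avoidAll ends a₂ {a₁} ∩ connEvent ends a₂ v) -
        prob p (avoidAll ends a₂ {a₁} ∩ connEvent ends a₁ v) := by
  have h := prob_PD_v_inter p ends a₁ a₂ v Set.univ
  simpa only [Set.inter_univ] using h

end Mixture

end OStar

end Mix

end Summit.Ventures.PercRepro2
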